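import Summits.Ventures.DiscreteObjects.Hadamard.Order6TypeITools

/-!
# H(4q), q ≡ 11 (mod 12): an order-6 automorphism whose cube is of TYPE I has an even number of 6-cycles — core case

Framing: lottery ticket; floor = certified bounds/negative ranges.

Cell pub-namedobj (venture DiscreteObjects), target (H), hadamard gen 14; continuation of `Order6NegaCore` (cube nega).  If the
cube `g³` of a signed automorphism `g = (π, κ, d, e)` with `g⁶ = 1` is an involution of TYPE I (it has fixed points; then its
sign type is `ε = +1`), every `6`-cycle of `π` has cycle sign product `+1`; after replacing `g` by `−g = (π, κ, −d, −e)` if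
necessary, the common sign of `g³` on its fixed points is `+1`, so the remaining cycles of `π` are `3`-cycles with sign product
`+1`, `2`-cycles with sign product `+1`, and fixed points (of either sign).  BLOCK NORMAL FORM treated here: index set
`(Fin 6 × A) ⊕ C`; on `Fin 6 × A` the plain shift `p ↦ p + 1` with all signs `+1`; on `C` ARBITRARY signed permutations
`(τr, dr)` (rows) and `(τc, dc)` (columns) whose signed permutation matrices `Q` satisfy `Q⁶ = 1` and `Q⁴ + Q³ − Q − 1 = 0`
(i.e. `(Q³ − 1)(Q + 1) = 0`: only `3`-cycles and `2`-cycles with sign product `+1` and fixed points).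

**`no_hadamard4q_six_typeI_blockform`**: if `|A|` is ODD, no Hadamard matrix of order `4q` (`q ≡ 11 (mod 12)` prime) on
`(Fin 6 × A) ⊕ C` has such a signed automorphism.  PROOF (the `E₁`-folding over `ℚ(√3)`): for `S = P + Pᵀ` the eigenvalue `1`
(primitive 6th roots of unity of `P`) occurs only on the `6`-blocks, with the orthogonal basis `U₀ = [[√3, √3, 0, −√3, −√3, 0],
[−1, 1, 2, 1, −1, −2]]` (norms `12`; the plane carries the form `⟨4, 12⟩ ≅ ⟨1, 3⟩`, which becomes `⟨1, 1⟩` only over `ℚ(√3)`);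
`R = −2(S² − 4)(S + 1) = 12·proj_{E₁(S)}` is a polynomial in `S`, it equals `U₀ᵀ U₀` on the `6`-blocks and VANISHES on `C`
because `(Q⁴ + Q³ − Q − 1) = 0` there (the polynomial identity `poly6_typeI_identity`).  Then `Uᵀ U = R`, `H R_c Hᵀ = 4q·R_r`,
`U R Uᵀ = 144·1` and `folding_two_squares_field` on `2|A| ≡ 2 (mod 4)` coordinates give `4q = u² + v²` in `ℚ(√3)`,
contradicting `not_sum_two_sq_4q_sqrtThree`.  Tools: `signedPermMatrix_pow` (powers of a signed permutation matrix),
`signedPermMatrix_mul_transpose`.  The transfer is `Order6TypeI`.  Ours; no `sorry`.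
-/

namespace Summit.Ventures.DiscreteObjects.Hadamard

open Finset BigOperators Matrix QuadraticAlgebra

open Literature.Combinatorics.Designs.GoethalsSeidel (IsHadamardMatrix)

section coreTypeI
variable {A C : Type*} [Fintype A] [DecidableEq A] [Fintype C] [DecidableEq C]

/-- **No H(4q), `q ≡ 11 (mod 12)` prime, in the type-I order-6 block normal form with an ODD number of 6-cycles.**  Index
`(Fin 6 × A) ⊕ C`, `|A|` odd, total cardinality `4q`; rows: shift `p ↦ p + 1` with signs `+1` on `Fin 6 × A` and `(τr, dr)` on
`C`; columns likewise with `(τc, dc)`; the signed permutation matrices `Qr`, `Qc` of the `C`-parts (over `ℚ(√3)`) satisfy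
`Q⁶ = 1` and `Q⁴ + Q³ − Q − 1 = 0`.  Then no Hadamard matrix has this signed automorphism. -/
theorem no_hadamard4q_six_typeI_blockform {q : ℕ} (hq : q.Prime) (hq12 : q % 12 = 11)
    (hcard : Fintype.card ((Fin 6 × A) ⊕ C) = 4 * q) (hA : Odd (Fintype.card A))
    (τr τc : Equiv.Perm C) (dr dc : C → ℤ)
    (Qr Qc : Matrix C C (QuadraticAlgebra ℚ 3 0))
    (hQr : Qr = fun k i => if k = τr i then ((dr i : ℤ) : QuadraticAlgebra ℚ 3 0) else 0)
    (hQc : Qc = fun k i => if k = τc i then ((dc i : ℤ) : QuadraticAlgebra ℚ 3 0) else 0)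
    (hQr6 : Qr ^ 6 = 1) (hQrrel : Qr ^ 4 + Qr ^ 3 - Qr - 1 = 0)
    (hQc6 : Qc ^ 6 = 1) (hQcrel : Qc ^ 4 + Qc ^ 3 - Qc - 1 = 0)
    (H : Matrix ((Fin 6 × A) ⊕ C) ((Fin 6 × A) ⊕ C) ℤ) (hH : IsHadamardMatrix H)
    (haut : IsSignedAut H
      (Equiv.sumCongr ((finRotate 6).prodCongr (Equiv.refl A)) τr)
      (Equiv.sumCongr ((finRotate 6).prodCongr (Equiv.refl A)) τc)
      (Sum.elim (fun _ => 1) dr) (Sum.elim (fun _ => 1) dc)) : False := by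
  haveI := sqrtThree_field_fact
  set r : QuadraticAlgebra ℚ 3 0 := ω with hrdef
  set σr : Equiv.Perm ((Fin 6 × A) ⊕ C) := Equiv.sumCongr ((finRotate 6).prodCongr (Equiv.refl A)) τr with hσrdef
  set σc : Equiv.Perm ((Fin 6 × A) ⊕ C) := Equiv.sumCongr ((finRotate 6).prodCongr (Equiv.refl A)) τc with hσcdef
  set d₀r : (Fin 6 × A) ⊕ C → ℤ := Sum.elim (fun _ => 1) dr with hd₀rdef
  set d₀c : (Fin 6 × A) ⊕ C → ℤ := Sum.elim (fun _ => 1) dc with hd₀cdef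
  have hdr : ∀ i, dr i = 1 ∨ dr i = -1 := fun i => haut.1 (Sum.inr i)
  have hdc : ∀ i, dc i = 1 ∨ dc i = -1 := fun i => haut.2.1 (Sum.inr i)
  have hσrl : ∀ (p : Fin 6) (a : A), σr (Sum.inl (p, a)) = Sum.inl (p + 1, a) := by intro p a; simp [hσrdef]
  have hσrr : ∀ (i : C), σr (Sum.inr i) = Sum.inr (τr i) := by intro i; simp [hσrdef]
  have hσcl : ∀ (p : Fin 6) (a : A), σc (Sum.inl (p, a)) = Sum.inl (p + 1, a) := by intro p a; simp [hσcdef]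
  have hσcr : ∀ (i : C), σc (Sum.inr i) = Sum.inr (τc i) := by intro i; simp [hσcdef]
  -- cardinalities
  have hα : Fintype.card (Fin 2 × A) % 4 = 2 := by
    obtain ⟨k, hk⟩ := hA
    rw [Fintype.card_prod, Fintype.card_fin, hk]; omega
  -- H over F
  set Hq : Matrix ((Fin 6 × A) ⊕ C) ((Fin 6 × A) ⊕ C) (QuadraticAlgebra ℚ 3 0) := H.map (Int.castRingHom _) with hHqdef
  have hHq : Hq * Hqᵀ = ((4 * q : ℕ) : QuadraticAlgebra ℚ 3 0) • (1 : Matrix _ _ _) := by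
    have h1 : Hq * Hqᵀ = (H * Hᵀ).map (Int.castRingHom _) := by
      rw [Matrix.map_mul, hHqdef, transpose_map]
    rw [h1, hH.2, hcard]
    ext i j : 1
    rw [Matrix.map_apply, Matrix.smul_apply, Matrix.smul_apply, Matrix.one_apply, Matrix.one_apply]
    split_ifs <;> simp
  -- the 6-blocks
  set N₆ : Matrix (Fin 6) (Fin 6) (QuadraticAlgebra ℚ 3 0) := fun k i => if k = i + 1 then 1 else 0 with hN₆def
  set S₆ : Matrix (Fin 6) (Fin 6) (QuadraticAlgebra ℚ 3 0) := N₆ + N₆ᵀ with hS₆def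
  set U₀ : Matrix (Fin 2) (Fin 6) (QuadraticAlgebra ℚ 3 0) := !![r, r, 0, -r, -r, 0; -1, 1, 2, 1, -1, -2] with hU₀def
  set S₆L : Matrix (Fin 6) (Fin 6) (QuadraticAlgebra ℚ 3 0) :=
    !![0, 1, 0, 0, 0, 1; 1, 0, 1, 0, 0, 0; 0, 1, 0, 1, 0, 0; 0, 0, 1, 0, 1, 0; 0, 0, 0, 1, 0, 1; 1, 0, 0, 0, 1, 0]
    with hS₆Ldef
  set T₆L : Matrix (Fin 6) (Fin 6) (QuadraticAlgebra ℚ 3 0) :=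
    !![2, 0, 1, 0, 1, 0; 0, 2, 0, 1, 0, 1; 1, 0, 2, 0, 1, 0; 0, 1, 0, 2, 0, 1; 1, 0, 1, 0, 2, 0; 0, 1, 0, 1, 0, 2]
    with hT₆Ldef
  set M₆L : Matrix (Fin 6) (Fin 6) (QuadraticAlgebra ℚ 3 0) :=
    !![-2, -1, 1, 2, 1, -1; -1, -2, -1, 1, 2, 1; 1, -1, -2, -1, 1, 2; 2, 1, -1, -2, -1, 1; 1, 2, 1, -1, -2, -1;
      -1, 1, 2, 1, -1, -2] with hM₆Ldef
  have hS₆L : S₆ = S₆L := by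
    rw [hS₆def, hS₆Ldef]; exact cyc6_add_transpose N₆ hN₆def
  have hM₆ : (S₆ * S₆ + (-4 : QuadraticAlgebra ℚ 3 0) • (1 : Matrix _ _ _)) * (S₆ + 1) = M₆L := by
    rw [hS₆L, hS₆Ldef, cyc6sym_sq, hM₆Ldef]; exact cyc6sym_cubic
  have hA1 : U₀ * U₀ᵀ = (12 : QuadraticAlgebra ℚ 3 0) • (1 : Matrix (Fin 2) (Fin 2) _) := by
    rw [hU₀def, hrdef]; exact fold6one_mul_transpose
  have hA2 : U₀ᵀ * U₀ = (-2 : QuadraticAlgebra ℚ 3 0) • M₆L := by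
    rw [hU₀def, hrdef, hM₆Ldef]; exact fold6one_transpose_mul
  -- the global signed permutation matrices
  set P : Matrix ((Fin 6 × A) ⊕ C) ((Fin 6 × A) ⊕ C) (QuadraticAlgebra ℚ 3 0) :=
    Matrix.fromBlocks (blockDiagonal (fun _ : A => N₆)) 0 0 Qr with hPdef
  set Q : Matrix ((Fin 6 × A) ⊕ C) ((Fin 6 × A) ⊕ C) (QuadraticAlgebra ℚ 3 0) :=
    Matrix.fromBlocks (blockDiagonal (fun _ : A => N₆)) 0 0 Qc with hQdef
  have hPspec : ∀ k i, P k i = if k = σr i then (d₀r i : QuadraticAlgebra ℚ 3 0) else 0 := by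
    rintro (⟨k, a⟩ | k) (⟨i, a'⟩ | i)
    · rw [hPdef, fromBlocks_apply₁₁, hσrl, hd₀rdef, Sum.elim_inl]
      by_cases ha : a = a'
      · subst ha
        rw [blockDiagonal_apply_eq]
        have e1 : (Sum.inl (k, a) = (Sum.inl (i + 1, a) : (Fin 6 × A) ⊕ C)) ↔ k = i + 1 := by simp
        simp only [hN₆def, e1]
        split_ifs <;> simp
      · rw [blockDiagonal_apply_ne _ _ _ ha]
        have e1 : ¬ (Sum.inl (k, a) = (Sum.inl (i + 1, a') : (Fin 6 × A) ⊕ C)) := by simp [ha]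
        rw [if_neg e1]
    · rw [hPdef, fromBlocks_apply₁₂, hσrr, Matrix.zero_apply]
      rw [if_neg (by simp)]
    · rw [hPdef, fromBlocks_apply₂₁, hσrl, Matrix.zero_apply]
      rw [if_neg (by simp)]
    · rw [hPdef, fromBlocks_apply₂₂, hσrr, hd₀rdef, Sum.elim_inr, hQr]
      simp only [Sum.inr.injEq]
  have hQspec : ∀ k i, Q k i = if k = σc i then (d₀c i : QuadraticAlgebra ℚ 3 0) else 0 := by
    rintro (⟨k, a⟩ | k) (⟨i, a'⟩ | i)
    · rw [hQdef, fromBlocks_apply₁₁, hσcl, hd₀cdef, Sum.elim_inl]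
      by_cases ha : a = a'
      · subst ha
        rw [blockDiagonal_apply_eq]
        have e1 : (Sum.inl (k, a) = (Sum.inl (i + 1, a) : (Fin 6 × A) ⊕ C)) ↔ k = i + 1 := by simp
        simp only [hN₆def, e1]
        split_ifs <;> simp
      · rw [blockDiagonal_apply_ne _ _ _ ha]
        have e1 : ¬ (Sum.inl (k, a) = (Sum.inl (i + 1, a') : (Fin 6 × A) ⊕ C)) := by simp [ha]
        rw [if_neg e1]
    · rw [hQdef, fromBlocks_apply₁₂, hσcr, Matrix.zero_apply]
      rw [if_neg (by simp)]
    · rw [hQdef, fromBlocks_apply₂₁, hσcl, Matrix.zero_apply]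
      rw [if_neg (by simp)]
    · rw [hQdef, fromBlocks_apply₂₂, hσcr, hd₀cdef, Sum.elim_inr, hQc]
      simp only [Sum.inr.injEq]
  have hPH : P * Hq = Hq * Q := sgnPerm_intertwine_gen haut P Q hPspec hQspec
  have hPtH : Pᵀ * Hq = Hq * Qᵀ := sgnPerm_transpose_intertwine_gen haut P Q hPspec hQspec
  -- S matrices in block form
  obtain ⟨SP, hSPdef⟩ : ∃ SP : Matrix ((Fin 6 × A) ⊕ C) ((Fin 6 × A) ⊕ C) (QuadraticAlgebra ℚ 3 0),
      SP = Matrix.fromBlocks (blockDiagonal (fun _ : A => S₆)) 0 0 (Qr + Qrᵀ) := ⟨_, rfl⟩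
  obtain ⟨SQ, hSQdef⟩ : ∃ SQ : Matrix ((Fin 6 × A) ⊕ C) ((Fin 6 × A) ⊕ C) (QuadraticAlgebra ℚ 3 0),
      SQ = Matrix.fromBlocks (blockDiagonal (fun _ : A => S₆)) 0 0 (Qc + Qcᵀ) := ⟨_, rfl⟩
  have hSP : P + Pᵀ = SP := by
    rw [hSPdef, hS₆def]; exact six_blocks_transpose_add N₆ Qr P hPdef
  have hSQ : Q + Qᵀ = SQ := by
    rw [hSQdef, hS₆def]; exact six_blocks_transpose_add N₆ Qc Q hQdef
  -- the cubic vanishes on the C-parts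
  have hQrQrt : Qr * Qrᵀ = 1 := signedPermMatrix_mul_transpose τr _ Qr hQr (fun i => by
    have := congrArg (Int.cast : ℤ → QuadraticAlgebra ℚ 3 0) (pm_mul_self (hdr i)); push_cast at this; exact this)
  have hQcQct : Qc * Qcᵀ = 1 := signedPermMatrix_mul_transpose τc _ Qc hQc (fun i => by
    have := congrArg (Int.cast : ℤ → QuadraticAlgebra ℚ 3 0) (pm_mul_self (hdc i)); push_cast at this; exact this)
  have hvanr := typeI_poly_vanish Qr hQrQrt hQr6 hQrrel
  have hvanc := typeI_poly_vanish Qc hQcQct hQc6 hQcrel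
  -- the Gram matrix Rm = −2 (S² − 4)(S + 1), the same explicit matrix on both sides
  obtain ⟨Rm, hRmdef⟩ : ∃ Rm : Matrix ((Fin 6 × A) ⊕ C) ((Fin 6 × A) ⊕ C) (QuadraticAlgebra ℚ 3 0),
      Rm = Matrix.fromBlocks (blockDiagonal (fun _ : A => (-2 : QuadraticAlgebra ℚ 3 0) • M₆L)) 0 0 0 := ⟨_, rfl⟩
  have hRmP : (-2 : QuadraticAlgebra ℚ 3 0) •
      ((SP * SP + (-4 : QuadraticAlgebra ℚ 3 0) • (1 : Matrix _ _ _)) * (SP + 1)) = Rm := by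
    rw [six_blocks_cubic S₆ (Qr + Qrᵀ) (-4) SP hSPdef, hvanr, hM₆, hRmdef, fromBlocks_smul, ← blockDiagonal_smul]
    simp only [smul_zero]
    rfl
  have hRmQ : (-2 : QuadraticAlgebra ℚ 3 0) •
      ((SQ * SQ + (-4 : QuadraticAlgebra ℚ 3 0) • (1 : Matrix _ _ _)) * (SQ + 1)) = Rm := by
    rw [six_blocks_cubic S₆ (Qc + Qcᵀ) (-4) SQ hSQdef, hvanc, hM₆, hRmdef, fromBlocks_smul, ← blockDiagonal_smul]
    simp only [smul_zero]
    rfl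
  -- the folding matrix U
  obtain ⟨U, hUdef⟩ : ∃ U : Matrix (Fin 2 × A) ((Fin 6 × A) ⊕ C) (QuadraticAlgebra ℚ 3 0),
      U = Matrix.fromCols (blockDiagonal (fun _ : A => U₀)) 0 := ⟨_, rfl⟩
  have hfold := six_blocks_fold U₀ _ (12 : QuadraticAlgebra ℚ 3 0) hA2 hA1 U hUdef
  have hV : Uᵀ * U = Rm := by rw [hRmdef]; exact hfold.1
  have hUU : U * Uᵀ = (12 : QuadraticAlgebra ℚ 3 0) • (1 : Matrix (Fin 2 × A) (Fin 2 × A) (QuadraticAlgebra ℚ 3 0)) :=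
    hfold.2
  -- forget the block structure
  clear hfold hUdef hRmdef hPspec hQspec hA2 hA1 hM₆ hS₆L hU₀def hS₆Ldef hT₆Ldef hM₆Ldef hS₆def hN₆def hvanr hvanc
    hQrQrt hQcQct hSPdef hSQdef hPdef hQdef
  clear_value P Q Hq r
  clear U₀ S₆L T₆L M₆L S₆ N₆
  have hHS : Hq * SQ = SP * Hq := by
    rw [← hSP, ← hSQ, Matrix.mul_add, Matrix.add_mul, ← hPH, ← hPtH]
  have hHR : Hq * Rm * Hqᵀ = ((4 * q : ℕ) : QuadraticAlgebra ℚ 3 0) • Rm := by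
    have h2 : Hq * Rm = Rm * Hq := by
      have h := cubic_intertwine Hq SQ SP (-4 : QuadraticAlgebra ℚ 3 0) hHS
      have h' := smul_intertwine Hq _ _ (-2 : QuadraticAlgebra ℚ 3 0) h
      rw [hRmQ, hRmP] at h'
      exact h'
    rw [h2, Matrix.mul_assoc, hHq, Matrix.mul_smul, Matrix.mul_one]
  have hU : U * Rm * Uᵀ = ((12 : QuadraticAlgebra ℚ 3 0) ^ 2) •
      (1 : Matrix (Fin 2 × A) (Fin 2 × A) (QuadraticAlgebra ℚ 3 0)) := by
    rw [← hV]
    exact gram_fold_sq U _ hUU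
  have h12 : (12 : QuadraticAlgebra ℚ 3 0) ≠ 0 := by
    intro h; have := congrArg QuadraticAlgebra.re h; simp at this
  obtain ⟨u, v, huv⟩ := folding_two_squares_field Hq Rm Rm U U (4 * q) (12 : QuadraticAlgebra ℚ 3 0) h12
    hV hHR hU (Equiv.refl _) hα
  have hcast : ((4 * q : ℕ) : QuadraticAlgebra ℚ 3 0) = 4 * (q : QuadraticAlgebra ℚ 3 0) := by
    rw [Nat.cast_mul, Nat.cast_ofNat]
  exact not_sum_two_sq_4q_sqrtThree hq hq12 ⟨u, v, by rw [huv, hcast]⟩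

end coreTypeI

end Summit.Ventures.DiscreteObjects.Hadamard
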